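import Literature.Geometry.Kaehler.RiemannSurfaceUnramifiedCoveringFunctionField
import Mathlib.Data.Finite.Perm
import HarnessLib

/-!
# The degree of the Galois closure of an unramified holomorphic covering: `d ∣ |G| ∣ d!`, `g(T) − 1 = |G| (g(N) − 1)`

Topic `Literature/Geometry/Kaehler` — numerical sequel of `RiemannSurfaceGaloisClosure` (the Galois closure
`T = Ñ ⧸ core(H)` of an unramified holomorphic covering `F : M → N` of compact connected Riemann surfaces,
`H = F_* π₁(M, x₀)`) and `RiemannSurfaceUnramifiedCoveringFunctionField` (`[𝒦 : 𝒦] =` index, Galois ⇔ normal): the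
group of the closure `G = π₁(N, x₀) ⧸ core(H)` has order divisible by the number `d` of sheets of `F` and dividing
`d!` (the normal core is the kernel of the permutation representation of `π₁` on the `d` cosets of `H`, Mathlib
`Subgroup.normalCore_eq_ker`), whence the genus bounds by Riemann–Hurwitz with `B = 0`.

## What is proved (everything; no definitions, no instances, no named facts)

* §1 (groups) `index_dvd_index_normalCore`, **`index_normalCore_dvd_factorial_index`** — `[G : H] ∣ [G : core H] ∣ [G : H]!`;
* §2 for an unramified holomorphic covering `F : M → N` of compact connected Riemann surfaces with `d` sheets:
  `ncard_preimage_dvd_index_normalCore`, **`index_normalCore_dvd_factorial_ncard`** (`d ∣ [π₁ : core(H)] ∣ d!`),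
  **`exists_galois_closure_degree`** — the Galois closure `t : T → N`, `s : T → M` (`F ∘ s = t`) has `[π₁ : core(H)]`
  sheets, `d ∣ [π₁ : core(H)] ∣ d!`, `g(T) − 1 = [π₁ : core(H)] · (g(N) − 1) = [H : core(H)] · (g(M) − 1)`, and its
  function field is a Galois extension of `t^*𝒦(N)` of degree `[π₁ : core(H)]`.

## References
* A. Hatcher, *Algebraic Topology*, CUP 2002, §1.3 Prop. 1.36, Prop. 1.39 (p. 71), Exercise 16 (p. 80). [HatcherAT2002]
* O. Forster, *Lectures on Riemann Surfaces*, GTM 81, Springer 1981, §8.3, §8.12 Theorem. [Forster1981]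
* H. M. Farkas, I. Kra, *Riemann Surfaces*, 2nd ed., GTM 71, Springer 1992, I.2.7. [FarkasKra1992]
-/

noncomputable section

open scoped Manifold ContDiff Topology IntermediateField
open Set Function MulAction Module

namespace Literature.Geometry.Kaehler

open Literature.Topology.CoveringSpaces

namespace RiemannSurface

open FunctionField

universe u v

/-! ### §1 `[G : H] ∣ [G : core H] ∣ [G : H]!` -/

/-- `[G : H] ∣ [G : core(H)]` (`core(H) ≤ H`). [cite: HatcherAT2002, §1.3 Exercise 16 (p. 80), Prop. 1.39] -/
theorem index_dvd_index_normalCore {G : Type*} [Group G] (H : Subgroup G) : H.index ∣ H.normalCore.index :=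
  Subgroup.index_dvd_of_le (Subgroup.normalCore_le H)

/-- **`[G : core(H)] ∣ [G : H]!`**: the normal core is the kernel of the permutation representation of `G` on the
`[G : H]` cosets of `H` (Mathlib `Subgroup.normalCore_eq_ker`), whose image is a subgroup of the symmetric group on
`[G : H]` letters. [cite: HatcherAT2002, §1.3 Exercise 16 (p. 80), Prop. 1.39] -/
theorem index_normalCore_dvd_factorial_index {G : Type*} [Group G] (H : Subgroup G) [H.FiniteIndex] :
    H.normalCore.index ∣ Nat.factorial H.index := by
  rw [Subgroup.normalCore_eq_ker, Subgroup.index_ker, Subgroup.index_eq_card, ← Nat.card_perm]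
  exact Subgroup.card_subgroup_dvd_card _

/-! ### §2 The degree and genus of the Galois closure of an unramified holomorphic covering -/

variable {M : Type u} [TopologicalSpace M] [ChartedSpace ℂ M] [ConnectedSpace M] [IsManifold 𝓘(ℂ, ℂ) ω M]
  [CompactSpace M] [T2Space M]
  {N : Type v} [TopologicalSpace N] [ChartedSpace ℂ N] [ConnectedSpace N] [IsManifold 𝓘(ℂ, ℂ) ω N]
  [CompactSpace N] [T2Space N]
  {F : M → N} (hF : MDifferentiable 𝓘(ℂ, ℂ) 𝓘(ℂ, ℂ) F) (hc : IsCoveringMap F)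

include hc in
omit [IsManifold 𝓘(ℂ, ℂ) ω M] [CompactSpace M] [T2Space M] [CompactSpace N] [IsManifold 𝓘(ℂ, ℂ) ω N] [T2Space N] in
/-- The number of sheets of `F` is the index of `F_* π₁(M, x₀)`, at every point.
[cite: HatcherAT2002, §1.3 Prop. 1.32 (p. 61)] -/
theorem ncard_preimage_eq_index_range_map (x₀ : M) (y : N) :
    (F ⁻¹' {y}).ncard = (FundamentalGroup.map (⟨F, hF.continuous⟩ : C(M, N)) x₀).range.index := by
  rw [ncard_preimage_eq_index_range_mapOfEq hc (⟨x₀, rfl⟩ : F ⁻¹' {F x₀}) y,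
    Literature.AlgebraicTopology.FundamentalGroup.index_range_mapOfEq]

include hc in
omit [IsManifold 𝓘(ℂ, ℂ) ω M] [CompactSpace M] [T2Space M] [CompactSpace N] [IsManifold 𝓘(ℂ, ℂ) ω N] [T2Space N] in
/-- `d ∣ [π₁(N, x₀) : core(F_* π₁(M, x₀))]` for the number `d` of sheets of `F`.
[cite: HatcherAT2002, §1.3 Prop. 1.32, Prop. 1.39, Exercise 16] -/
theorem ncard_preimage_dvd_index_normalCore (x₀ : M) (y : N) :
    (F ⁻¹' {y}).ncard ∣ (FundamentalGroup.map (⟨F, hF.continuous⟩ : C(M, N)) x₀).range.normalCore.index := by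
  rw [ncard_preimage_eq_index_range_map hF hc x₀ y]
  exact index_dvd_index_normalCore _

include hc in
omit [T2Space M] in
/-- **`[π₁(N, x₀) : core(F_* π₁(M, x₀))] ∣ d!`**: the group of the Galois closure of a `d`-sheeted unramified
holomorphic covering embeds in the symmetric group on the `d` sheets. [cite: HatcherAT2002, §1.3 Prop. 1.39, Exercise 16 (p. 80)] -/
theorem index_normalCore_dvd_factorial_ncard (x₀ : M) (y : N) :
    (FundamentalGroup.map (⟨F, hF.continuous⟩ : C(M, N)) x₀).range.normalCore.index ∣ Nat.factorial (F ⁻¹' {y}).ncard := by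
  haveI := finiteIndex_range_map hF hc.exists_apply_ne_of_compactSpace x₀
  rw [ncard_preimage_eq_index_range_map hF hc x₀ y]
  exact index_normalCore_dvd_factorial_index _

include hc in
/-- **The degree and genus of the Galois closure.**  For an unramified holomorphic covering `F : M → N` of compact
connected Riemann surfaces with `d` sheets and `H = F_* π₁(M, x₀)`, the Galois closure (`exists_galois_closure`) is a
compact connected Riemann surface `T` with holomorphic covering maps `t : T → N` (Galois, `[π₁ : core(H)]` sheets) and
`s : T → M`, `F ∘ s = t`, such that `d ∣ [π₁ : core(H)] ∣ d!`, `g(T) − 1 = [π₁ : core(H)] · (g(N) − 1)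
= [H : core(H)] · (g(M) − 1)`, and `𝒦(T)/t^*𝒦(N)` is a Galois extension of degree `[π₁ : core(H)]`.
[cite: HatcherAT2002, §1.3 Prop. 1.36, Prop. 1.39 (p. 71), Exercise 16 (p. 80)] [cite: Forster1981, §8.3, §8.12 Theorem]
[cite: FarkasKra1992, I.2.7] -/
theorem exists_galois_closure_degree (x₀ : M) :
    ∃ (T : Type v) (_ : TopologicalSpace T) (_ : ChartedSpace ℂ T) (_ : IsManifold 𝓘(ℂ, ℂ) ω T)
      (_ : CompactSpace T) (_ : T2Space T) (_ : ConnectedSpace T) (t : T → N)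
      (ht : MDifferentiable 𝓘(ℂ, ℂ) 𝓘(ℂ, ℂ) t) (htne : ∃ a b, t a ≠ t b) (s : T → M),
      IsCoveringMap t ∧ IsCoveringMap s ∧ MDifferentiable 𝓘(ℂ, ℂ) 𝓘(ℂ, ℂ) s ∧ (∀ a, F (s a) = t a) ∧
        (∀ y, (t ⁻¹' {y}).ncard = (FundamentalGroup.map (⟨F, hF.continuous⟩ : C(M, N)) x₀).range.normalCore.index) ∧
        (F ⁻¹' {F x₀}).ncard ∣ (FundamentalGroup.map (⟨F, hF.continuous⟩ : C(M, N)) x₀).range.normalCore.index ∧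
        (FundamentalGroup.map (⟨F, hF.continuous⟩ : C(M, N)) x₀).range.normalCore.index ∣
          Nat.factorial (F ⁻¹' {F x₀}).ncard ∧
        (arithGenus T : ℤ) - 1 =
          (FundamentalGroup.map (⟨F, hF.continuous⟩ : C(M, N)) x₀).range.normalCore.index * ((arithGenus N : ℤ) - 1) ∧
        (arithGenus T : ℤ) - 1 =
          (FundamentalGroup.map (⟨F, hF.continuous⟩ : C(M, N)) x₀).range.normalCore.relIndex
              (FundamentalGroup.map (⟨F, hF.continuous⟩ : C(M, N)) x₀).range * ((arithGenus M : ℤ) - 1) ∧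
        IsGalois ↥(comap t ht htne).fieldRange (FunctionField T) ∧
        finrank ↥(comap t ht htne).fieldRange (FunctionField T) =
          (FundamentalGroup.map (⟨F, hF.continuous⟩ : C(M, N)) x₀).range.normalCore.index := by
  set H := (FundamentalGroup.map (⟨F, hF.continuous⟩ : C(M, N)) x₀).range with hH
  have hne : ∃ a b, F a ≠ F b := hc.exists_apply_ne_of_compactSpace
  haveI : H.FiniteIndex := finiteIndex_range_map hF hne x₀
  obtain ⟨T, i1, i2, i3, i4, i5, i6, i7, t, htc, t₀, ht₀, s, S, -, -, htd, -, -, -, hcard, -, hrange, hsc, hsd, -, hFs,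
    -, -, -, hgenus⟩ := exists_galois_closure hF hc x₀
  have htne : ∃ a b, t a ≠ t b := htc.exists_apply_ne_of_compactSpace
  -- the function field: normal subgroup `core(H) = t_* π₁(T, t₀)`, hence Galois of degree the index
  have hN : (FundamentalGroup.mapOfEq ⟨t, htc.continuous⟩ (⟨t₀, ht₀⟩ : t ⁻¹' {F x₀}).2).range.Normal := by
    rw [show (FundamentalGroup.mapOfEq ⟨t, htc.continuous⟩ (⟨t₀, ht₀⟩ : t ⁻¹' {F x₀}).2).range = H.normalCore
      from hrange]
    infer_instance
  have hG := (isGalois_and_natCard_algEquiv_eq_index_of_normal htd htne htc ⟨t₀, ht₀⟩ hN).1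
  have hdeg : finrank ↥(comap t htd htne).fieldRange (FunctionField T) = H.normalCore.index := by
    rw [finrank_fieldRange_comap_eq_index htd htne htc (⟨t₀, ht₀⟩ : t ⁻¹' {F x₀}),
      show (FundamentalGroup.mapOfEq ⟨t, htc.continuous⟩ (⟨t₀, ht₀⟩ : t ⁻¹' {F x₀}).2).range = H.normalCore
        from hrange]
  refine ⟨T, i1, i2, i3, i4, i5, i6, t, htd, htne, s, htc, hsc, hsd, hFs, hcard,
    ncard_preimage_dvd_index_normalCore hF hc x₀ (F x₀), index_normalCore_dvd_factorial_ncard hF hc x₀ (F x₀),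
    hgenus, ?_, hG, hdeg⟩
  -- `g(T) − 1 = [π₁ : core H] (g(N) − 1) = [H : core H] · [π₁ : H] (g(N) − 1) = [H : core H] (g(M) − 1)`
  have hM : (arithGenus M : ℤ) - 1 = (F ⁻¹' {F x₀}).ncard * ((arithGenus N : ℤ) - 1) :=
    hc.arithGenus_sub_one_eq hF hne (F x₀)
  have hidx : H.normalCore.relIndex H * H.index = H.normalCore.index :=
    Subgroup.relIndex_mul_index (Subgroup.normalCore_le H)
  rw [hgenus, hM, ncard_preimage_eq_index_range_map hF hc x₀ (F x₀), ← hidx]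
  push_cast
  ring

end RiemannSurface

end Literature.Geometry.Kaehler

end
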